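import Mathlib.Analysis.InnerProductSpace.PiL2
import Mathlib.Analysis.InnerProductSpace.Calculus
import Mathlib.Analysis.SpecialFunctions.Pow.Deriv
import Mathlib.Analysis.SpecialFunctions.ExpDeriv
import HarnessLib

/-!
# Huisken's backward heat kernel: derivatives and the pointwise monotonicity identity

Topic `Literature/Geometry/Riemannian`. The backward heat kernel of an `n`-dimensional mean
curvature flow in a Euclidean space `V`, centred at `(x₀, T)`, is
`ρ(x, t) = (4π(T - t))^{-n/2} e^{-‖x - x₀‖²/4(T - t)}`; writing `τ = T - t`, `y = x - x₀`:

* `hasDerivAt_huiskenKernel_time` (with `hasDerivAt_normalization`, `hasDerivAt_exp_neg_sq_div`)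
  — `∂_τ ρ = ρ (‖y‖²/(4τ²) - n/(2τ))`, i.e. `∂ₜρ = ρ (n/(2τ) - ‖y‖²/(4τ²))`;
* `hasFDerivAt_exp_neg_norm_sq_div` — `∇ρ = -(ρ/(2τ)) y`;
* `inner_fderiv_gaussGradient` — `Hess ρ(a, b) = ρ (⟪y, a⟫⟪y, b⟫/(4τ²) - ⟪a, b⟫/(2τ))`
  (differential of the gradient field);
* `norm_sq_eq_sum_sq_inner_add_norm_sq_sub` — Pythagoras for an orthonormal family;
* `huisken_kernel_identity_div`, `huisken_kernel_identity` — **Huisken's pointwise identity**: for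
  every `n`-plane `T` with orthonormal basis `e₁, …, e_n`,
  `∂ₜρ + tr_T Hess ρ + |∇^⊥ρ|²/ρ = 0`,
  the algebraic heart of the monotonicity formula
  `d/dt ∫_{M_t} ρ = -∫_{M_t} ρ |H ν + ∇^⊥ρ/ρ|²` (combined with `∂ₜ dμ = -H² dμ`,
  `MCFMetricEvolution.lean`, and `∫ Δ_M ρ = 0`).

Everything is PROVED; no definitions, no named facts.

## References

* G. Huisken, *Asymptotic behavior for singularities of the mean curvature flow*, J. Differential
  Geom. 31 (1990) 285–299, proof of Thm. 3.1. [Huisken1990]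
* C. Mantegazza, *Lecture Notes on Mean Curvature Flow*, Birkhäuser 2011, §3.2 (Lemma 3.2.5 and
  the proof of Huisken's monotonicity formula, Thm. 3.2.7). [Mantegazza2011]
-/

noncomputable section

open Set Function Filter Real
open scoped Topology RealInnerProductSpace

namespace Literature.Geometry.Riemannian

variable {V : Type*} [NormedAddCommGroup V] [InnerProductSpace ℝ V]

/-! ### Pythagoras for an orthonormal family -/

/-- **Pythagoras for an orthonormal family**: `‖y‖² = Σᵢ ⟪y, eᵢ⟫² + ‖y - Σᵢ ⟪y, eᵢ⟫ eᵢ‖²`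
(the tangential and normal parts of `y` relative to the plane spanned by `e`). [folklore] -/
theorem norm_sq_eq_sum_sq_inner_add_norm_sq_sub {ι : Type*} [Fintype ι] {e : ι → V}
    (he : Orthonormal ℝ e) (y : V) :
    ‖y‖ ^ 2 = ∑ i, ⟪y, e i⟫ ^ 2 + ‖y - ∑ i, ⟪y, e i⟫ • e i‖ ^ 2 := by
  set P : V := ∑ i, ⟪y, e i⟫ • e i with hP
  -- `⟪P, P⟫ = Σ ⟪y, eᵢ⟫²` and `⟪y, P⟫ = Σ ⟪y, eᵢ⟫²`
  have hPP : ⟪P, P⟫ = ∑ i, ⟪y, e i⟫ ^ 2 := by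
    rw [hP, he.inner_sum]
    exact Finset.sum_congr rfl fun i _ ↦ by simp [pow_two]
  have hyP : ⟪y, P⟫ = ∑ i, ⟪y, e i⟫ ^ 2 := by
    rw [hP, inner_sum]
    refine Finset.sum_congr rfl fun i _ ↦ ?_
    rw [real_inner_smul_right]; ring
  have h1 : ‖y - P‖ ^ 2 = ‖y‖ ^ 2 - 2 * ⟪y, P⟫ + ‖P‖ ^ 2 := norm_sub_sq_real y P
  rw [h1, hyP, ← real_inner_self_eq_norm_sq P, hPP]
  ring

/-! ### Huisken's identity for the backward heat kernel, algebraic core -/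

/-- **Huisken's identity, normalised by `ρ`.** For `τ > 0`, `y ∈ V` and an orthonormal family
`e₁, …, e_k` (spanning the tangent `k`-plane `T`), with `ρ(y, τ) = (4πτ)^{-k/2} e^{-‖y‖²/4τ}`,
`t = T - τ`:

  `∂ₜρ/ρ + (tr_T Hess ρ)/ρ + |∇^⊥ρ|²/ρ² = 0`, i.e.
  `(k/(2τ) - ‖y‖²/(4τ²)) + Σᵢ (⟪y, eᵢ⟫²/(4τ²) - 1/(2τ)) + ‖y - Σᵢ ⟪y, eᵢ⟫ eᵢ‖²/(4τ²) = 0`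

(`∂ₜρ = ρ (k/(2τ) - ‖y‖²/(4τ²))`, `Hess ρ(a, b) = ρ (⟪y,a⟫⟪y,b⟫/(4τ²) - ⟪a,b⟫/(2τ))`,
`∇ρ = -ρ y/(2τ)`), by Pythagoras. This is the pointwise identity behind Huisken's monotonicity
formula. [cite: Huisken1990, proof of Thm. 3.1] [cite: Mantegazza2011, Lemma 3.2.5] -/
theorem huisken_kernel_identity_div {ι : Type*} [Fintype ι] {e : ι → V} (he : Orthonormal ℝ e)
    (y : V) {τ : ℝ} (hτ : τ ≠ 0) :
    ((Fintype.card ι : ℝ) / (2 * τ) - ‖y‖ ^ 2 / (4 * τ ^ 2)) +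
      ∑ i, (⟪y, e i⟫ ^ 2 / (4 * τ ^ 2) - 1 / (2 * τ)) +
      ‖y - ∑ i, ⟪y, e i⟫ • e i‖ ^ 2 / (4 * τ ^ 2) = 0 := by
  have hpy := norm_sq_eq_sum_sq_inner_add_norm_sq_sub he y
  rw [Finset.sum_sub_distrib, Finset.sum_const, Finset.card_univ, nsmul_eq_mul, ← Finset.sum_div]
  have h4 : (4 : ℝ) * τ ^ 2 ≠ 0 := by positivity
  have key : -‖y‖ ^ 2 + ∑ i, ⟪y, e i⟫ ^ 2 + ‖y - ∑ i, ⟪y, e i⟫ • e i‖ ^ 2 = 0 := by linarith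
  have : ((Fintype.card ι : ℝ) / (2 * τ) - ‖y‖ ^ 2 / (4 * τ ^ 2)) +
      ((∑ i, ⟪y, e i⟫ ^ 2) / (4 * τ ^ 2) - (Fintype.card ι : ℝ) * (1 / (2 * τ))) +
      ‖y - ∑ i, ⟪y, e i⟫ • e i‖ ^ 2 / (4 * τ ^ 2) =
      (-‖y‖ ^ 2 + ∑ i, ⟪y, e i⟫ ^ 2 + ‖y - ∑ i, ⟪y, e i⟫ • e i‖ ^ 2) / (4 * τ ^ 2) := by
    field_simp
    ring
  rw [this, key, zero_div]

/-- **Huisken's identity** (multiplied through by `ρ > 0`): with the same notation,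
`∂ₜρ + tr_T Hess ρ + |∇^⊥ρ|²/ρ = 0` where `∂ₜρ = ρ (k/(2τ) - ‖y‖²/(4τ²))`,
`tr_T Hess ρ = Σᵢ ρ (⟪y, eᵢ⟫²/(4τ²) - 1/(2τ))` and `∇^⊥ρ = -(ρ/(2τ)) (y - Σ ⟪y, eᵢ⟫ eᵢ)`.
[cite: Huisken1990, proof of Thm. 3.1] [cite: Mantegazza2011, Lemma 3.2.5] -/
theorem huisken_kernel_identity {ι : Type*} [Fintype ι] {e : ι → V} (he : Orthonormal ℝ e)
    (y : V) {τ ρ : ℝ} (hτ : τ ≠ 0) (hρ : ρ ≠ 0) :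
    ρ * ((Fintype.card ι : ℝ) / (2 * τ) - ‖y‖ ^ 2 / (4 * τ ^ 2)) +
      ∑ i, ρ * (⟪y, e i⟫ ^ 2 / (4 * τ ^ 2) - 1 / (2 * τ)) +
      ‖(-(ρ / (2 * τ))) • (y - ∑ i, ⟪y, e i⟫ • e i)‖ ^ 2 / ρ = 0 := by
  have h := huisken_kernel_identity_div he y hτ
  rw [← Finset.mul_sum, norm_smul, mul_pow, Real.norm_eq_abs, sq_abs]
  have hρ2 : (-(ρ / (2 * τ))) ^ 2 * ‖y - ∑ i, ⟪y, e i⟫ • e i‖ ^ 2 / ρ =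
      ρ * (‖y - ∑ i, ⟪y, e i⟫ • e i‖ ^ 2 / (4 * τ ^ 2)) := by
    field_simp
    ring
  rw [hρ2, ← mul_add, ← mul_add, h, mul_zero]

/-! ### The derivatives of the kernel -/

/-- Time derivative of the Gaussian factor: `d/dτ e^{-r²/(4τ)} = e^{-r²/(4τ)} · r²/(4τ²)`.
[folklore] -/
theorem hasDerivAt_exp_neg_sq_div (r : ℝ) {τ : ℝ} (hτ : τ ≠ 0) :
    HasDerivAt (fun σ : ℝ ↦ Real.exp (-r ^ 2 / (4 * σ)))
      (Real.exp (-r ^ 2 / (4 * τ)) * (r ^ 2 / (4 * τ ^ 2))) τ := by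
  have h1 : HasDerivAt (fun σ : ℝ ↦ -r ^ 2 / (4 * σ)) (r ^ 2 / (4 * τ ^ 2)) τ := by
    have h := (hasDerivAt_inv hτ).const_mul (-r ^ 2 / 4)
    have hfun : (fun σ : ℝ ↦ -r ^ 2 / (4 * σ)) = fun σ ↦ -r ^ 2 / 4 * σ⁻¹ := by
      funext σ; ring
    rw [hfun]
    refine h.congr_deriv ?_
    field_simp
  exact (h1.exp).congr_deriv (by ring)

/-- Time derivative of the normalisation: `d/dτ (4πτ)^{-k/2} = (4πτ)^{-k/2} · (-k/(2τ))`, `τ > 0`.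
[folklore] -/
theorem hasDerivAt_normalization (k : ℕ) {τ : ℝ} (hτ : 0 < τ) :
    HasDerivAt (fun σ : ℝ ↦ (4 * Real.pi * σ) ^ (-(k : ℝ) / 2))
      ((4 * Real.pi * τ) ^ (-(k : ℝ) / 2) * (-(k : ℝ) / (2 * τ))) τ := by
  have hpos : 0 < 4 * Real.pi * τ := by positivity
  have h1 : HasDerivAt (fun σ : ℝ ↦ 4 * Real.pi * σ) (4 * Real.pi) τ := by
    simpa using (hasDerivAt_id τ).const_mul (4 * Real.pi)
  have h2 := h1.rpow_const (p := -(k : ℝ) / 2) (Or.inl hpos.ne')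
  refine h2.congr_deriv ?_
  rw [show -(k : ℝ) / 2 - 1 = -(k : ℝ) / 2 + (-1) by ring, Real.rpow_add hpos, Real.rpow_neg_one]
  field_simp

/-- **Time derivative of the kernel**: for `ρ(τ) = (4πτ)^{-k/2} e^{-r²/(4τ)}`,
`dρ/dτ = ρ (r²/(4τ²) - k/(2τ))`, so that `∂ₜρ = ρ (k/(2τ) - r²/(4τ²))` for `τ = T - t`.
[cite: Mantegazza2011, Lemma 3.2.5] -/
theorem hasDerivAt_huiskenKernel_time (k : ℕ) (r : ℝ) {τ : ℝ} (hτ : 0 < τ) :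
    HasDerivAt (fun σ : ℝ ↦ (4 * Real.pi * σ) ^ (-(k : ℝ) / 2) * Real.exp (-r ^ 2 / (4 * σ)))
      ((4 * Real.pi * τ) ^ (-(k : ℝ) / 2) * Real.exp (-r ^ 2 / (4 * τ)) *
        (r ^ 2 / (4 * τ ^ 2) - (k : ℝ) / (2 * τ))) τ := by
  have h := (hasDerivAt_normalization k hτ).mul (hasDerivAt_exp_neg_sq_div r hτ.ne')
  refine h.congr_deriv ?_
  ring

/-- **Gradient of the Gaussian factor**: `D(e^{-‖x-p‖²/4τ})_x a = -(e^{…}/(2τ)) ⟪x - p, a⟫`, i.e.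
`∇E = -(E/(2τ)) (x - p)`. [folklore] -/
theorem hasFDerivAt_exp_neg_norm_sq_div (p : V) {τ : ℝ} (x : V) :
    HasFDerivAt (fun z : V ↦ Real.exp (-‖z - p‖ ^ 2 / (4 * τ)))
      ((-(Real.exp (-‖x - p‖ ^ 2 / (4 * τ)) / (2 * τ))) • innerSL ℝ (x - p)) x := by
  have h1 : HasFDerivAt (fun z : V ↦ ‖z - p‖ ^ 2) (2 • innerSL ℝ (x - p)) x := by
    have h := (hasStrictFDerivAt_norm_sq (x - p)).hasFDerivAt
    exact h.comp x ((hasFDerivAt_id x).sub_const p)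
  have h2 : HasFDerivAt (fun z : V ↦ -‖z - p‖ ^ 2 / (4 * τ)) ((-(1 / (4 * τ))) • (2 • innerSL ℝ (x - p))) x := by
    have h := (h1.const_mul (-(1 / (4 * τ))))
    refine h.congr_of_eventuallyEq (Eventually.of_forall fun z ↦ ?_) |>.congr_fderiv (by rfl)
    show -‖z - p‖ ^ 2 / (4 * τ) = -(1 / (4 * τ)) * ‖z - p‖ ^ 2
    ring
  have h3 := h2.exp
  refine h3.congr_fderiv ?_
  ext a
  simp only [FunLike.coe_smul, Pi.smul_apply, innerSL_apply_apply, smul_eq_mul]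
  by_cases hτ : τ = 0
  · subst hτ; simp
  · field_simp
    ring

/-- **Differential of the gradient field** `G(x) = -(E(x)/(2τ)) (x - p)` of the Gaussian factor:
`DG_x a = (E/(4τ²)) ⟪x - p, a⟫ (x - p) - (E/(2τ)) a`, whence the Hessian
`Hess E(a, b) = ⟪DG_x a, b⟫ = E (⟪x-p, a⟫⟪x-p, b⟫/(4τ²) - ⟪a, b⟫/(2τ))`. [folklore] -/
theorem inner_fderiv_gaussGradient (p : V) {τ : ℝ} (hτ : τ ≠ 0) (x a b : V) :
    HasFDerivAt (fun z : V ↦ (-(Real.exp (-‖z - p‖ ^ 2 / (4 * τ)) / (2 * τ))) • (z - p))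
      ((Real.exp (-‖x - p‖ ^ 2 / (4 * τ)) / (4 * τ ^ 2)) •
          (innerSL ℝ (x - p)).smulRight (x - p) +
        (-(Real.exp (-‖x - p‖ ^ 2 / (4 * τ)) / (2 * τ))) • ContinuousLinearMap.id ℝ V) x ∧
    ⟪((Real.exp (-‖x - p‖ ^ 2 / (4 * τ)) / (4 * τ ^ 2)) •
          (innerSL ℝ (x - p)).smulRight (x - p) +
        (-(Real.exp (-‖x - p‖ ^ 2 / (4 * τ)) / (2 * τ))) • ContinuousLinearMap.id ℝ V) a, b⟫ =
      Real.exp (-‖x - p‖ ^ 2 / (4 * τ)) *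
        (⟪x - p, a⟫ * ⟪x - p, b⟫ / (4 * τ ^ 2) - ⟪a, b⟫ / (2 * τ)) := by
  set E : V → ℝ := fun z ↦ Real.exp (-‖z - p‖ ^ 2 / (4 * τ)) with hE
  constructor
  · -- product rule for `z ↦ c(z) • (z - p)` with `c = -E/(2τ)`
    have hc : HasFDerivAt (fun z : V ↦ -(E z / (2 * τ)))
        ((-(1 / (2 * τ))) • ((-(E x / (2 * τ))) • innerSL ℝ (x - p))) x := by
      have h := (hasFDerivAt_exp_neg_norm_sq_div p (τ := τ) x).const_mul (-(1 / (2 * τ)))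
      refine h.congr_of_eventuallyEq (Eventually.of_forall fun z ↦ ?_)
      show -(E z / (2 * τ)) = -(1 / (2 * τ)) * Real.exp (-‖z - p‖ ^ 2 / (4 * τ))
      simp only [hE]
      ring
    have hv : HasFDerivAt (fun z : V ↦ z - p) (ContinuousLinearMap.id ℝ V) x :=
      (hasFDerivAt_id x).sub_const p
    have h : HasFDerivAt (fun z : V ↦ (-(E z / (2 * τ))) • (z - p))
        ((-(E x / (2 * τ))) • ContinuousLinearMap.id ℝ V +
          ((-(1 / (2 * τ))) • ((-(E x / (2 * τ))) • innerSL ℝ (x - p))).smulRight (x - p)) x :=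
      hc.smul hv
    refine h.congr_fderiv ?_
    ext a'
    simp only [hE, FunLike.coe_add, Pi.add_apply, FunLike.coe_smul, Pi.smul_apply,
      ContinuousLinearMap.smulRight_apply, innerSL_apply_apply, ContinuousLinearMap.id_apply, smul_smul]
    rw [add_comm]
    congr 1
    congr 1
    simp only [smul_eq_mul]
    field_simp
    ring
  · simp only [FunLike.coe_add, Pi.add_apply, FunLike.coe_smul, Pi.smul_apply,
      ContinuousLinearMap.smulRight_apply, innerSL_apply_apply, ContinuousLinearMap.id_apply, smul_smul,
      inner_add_left, real_inner_smul_left]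
    ring

end Literature.Geometry.Riemannian

end
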